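import Summits.QuantumFields.YangMills.Theorems.IR.VacuumEscapeCheeger
import HarnessLib

/-!
# Crux `IR` (stmt-QuantumFields-19354), line `vacuum_escape` v4: the vacuum-state currency and its CHEEGER SEAM PROVED —
`vacuumConductance_imp_sliceGap : ∀ G r a, (∀ β, 0 < a β) → VacuumConductanceInUnits G r a → SliceGapInUnits G r a`

Helper module for item `stmt-QuantumFields-19354` (`--supports … --as helper`).  Skeleton v4 of `Cruxes/IR/Lines/vacuum_escape.lean`
(ideator ym-ir-idea-8, 2144033a397a, 2026-08-28T01:06Z) re-denominated the line's load in the VACUUM STATE of Lüscher's transfer matrix: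
`IsVacuum`, `vacuumMeasure Ω = Ω² dU`, `vacuumCoupling ρ β N Ω = Ω(U) K_β(U,U') Ω(U')/‖𝕋‖ dU dU'`, and the load
`∀ Ω, IsVacuum … Ω → HasCouplingConductance (vacuumMeasure Ω) (vacuumCoupling … Ω) (c√(aβ))`.  Those three definitions are vendored here VERBATIM;
the v4 load is vendored VERBATIM under the name `VacuumConductanceInUnits` (v4 calls it `SliceConductanceInUnits`, but that name is already the
tree constant of the v3 load, `Theorems/IR/VacuumEscapeDefs.lean` p590997 — the v4 skeleton should rename and re-base), and likewise the v4 rung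
as `VacuumConductanceStrongCoupling`.  The v4 seam `stub_cheeger : SliceConductanceInUnits(v4) → SliceGapInUnits` then closes by
`exact vacuumConductance_imp_sliceGap` after the rename.

Proof: per `(β ≥ 0, S)`, the pointwise ground state `h` of the slice kernel (`GroundState.exists_groundState_data`, p591804) gives a vacuum vector
`Ω = [h]`; the hypothesis at `Ω` is the conductance of the ground-state coupling, whose set functions are `π(A) = ∫_A h²`,
`Q(A × Aᶜ) = ∫_A h² − λ₀⁻¹ ∫_A∫_A h K h` (densities agree a.e. with the `h`-versions); `GroundState.eigenvalue_le_of_conductance` (p591710: the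
tree's Lawler–Sokal `cheeger_variance_le_dirichletForm` + the Dirichlet identity of the ground-state transform) bounds every other eigenvalue by
`λ₀(1 − k²/8)`, and the trace formula `Z = Σ λᵢ^t` gives `traceExcess t ≤ x₂ e^{k²/4} e^{−(k²/8)t}`, `k = c√(aβ)`, i.e. `SliceGapInUnits` with
`c₁ = c²/8` — the v3 proof (`VacuumEscapeCheeger.lean`, p592286) minus its limit layer.

HONEST FRAMING: a seam between two currencies of ONE line of an OPEN gap-crux; the load (vacuum conductance at weak coupling) is untouched;
nothing here proves weak-coupling mixing or the YM mass gap (Clay); `R4` closes only the conditional rung `BalabanLadder.UV`.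
Refs: G. F. Lawler, A. D. Sokal, Trans. AMS 309 (1988) 557, Thm 2.1; Reed–Simon IV Thm XIII.43–44; M. Lüscher, CMP 54 (1977) 283; tree files above.
-/

set_option autoImplicit false

noncomputable section

open MeasureTheory Filter Set Function
open scoped RealInnerProductSpace ENNReal Topology
open Literature.Analysis.OperatorTheory Literature.MathematicalPhysics.QuantumFieldTheory Literature.Probability.MarkovChains
open Summit.QuantumFields.YangMills.Cruxes.IR.VacuumEscape.GroundState

namespace Summit.QuantumFields.YangMills.Cruxes.IR.VacuumEscape

/-! ## §0 Vocabulary of skeleton v4 (VERBATIM): the vacuum measure and the vacuum coupling -/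

section SliceChain

open Literature.Analysis.OperatorTheory (IsStrictlyPositiveFun)

variable {N n : ℕ} [NeZero N] {G : Type*} [Group G] [TopologicalSpace G] [IsTopologicalGroup G] [CompactSpace G]
  [MeasurableSpace G] [BorelSpace G] (ρ : G →* Matrix (Fin n) (Fin n) ℂ)

/-- A **vacuum vector** of Lüscher's transfer matrix `𝕋 = wilsonTorusTransferMatrix ρ β N`: a unit top eigenvector that is a.e.
positive (`𝕋 Ω = ‖𝕋‖ Ω`, `‖Ω‖ = 1`, `Ω > 0` a.e.).  For continuous unitary `ρ` and `β ≥ 0` one exists and is unique (tree: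
`exists_spectralData_wilsonTorusTransferMatrix`, `IsPositivityImproving.top_eigenvector_abs`, `….strictlyPositive_of_eigen`,
`….simple_top_eigenvalue`); the currency quantifies over all of them, so no choice is made here. (v4 skeleton, verbatim) -/
def IsVacuum (β : ℝ) (N : ℕ) [NeZero N]
    (Ω : Lp ℝ 2 (Measure.pi fun _ : Edge 3 N => haarProbability G)) : Prop :=
  ‖Ω‖ = 1 ∧ wilsonTorusTransferMatrix ρ β N Ω = ‖wilsonTorusTransferMatrix ρ β N‖ • Ω ∧ IsStrictlyPositiveFun Ω

/-- The **vacuum measure** `π = Ω² · ∏ dHaar` on time-zero slice configurations (a probability measure when `‖Ω‖ = 1`). (v4 skeleton, verbatim) -/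
def vacuumMeasure (Ω : Lp ℝ 2 (Measure.pi fun _ : Edge 3 N => haarProbability G)) : Measure (GaugeConfig 3 N G) :=
  (Measure.pi fun _ : Edge 3 N => haarProbability G).withDensity fun U => ENNReal.ofReal ((Ω U) ^ 2)

/-- The **vacuum coupling** `Q(dU, dU') = Ω(U) K_β(U, U') Ω(U') / ‖𝕋‖ · dU dU'`: the joint law of two consecutive time slices of the
infinite-time torus `∞ × N³` (ground-state transform of the transfer kernel).  Its marginals are `π` (`𝕋Ω = ‖𝕋‖Ω`, `K_β` symmetric), it is
swap-symmetric (reversibility), and `½∫(f(U) − f(U'))² dQ = ∫ f² dπ − ⟨fΩ, 𝕋(fΩ)⟩/‖𝕋‖` is the Dirichlet form of the vacuum chain. (v4 skeleton,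
verbatim) -/
def vacuumCoupling (β : ℝ) (N : ℕ) [NeZero N]
    (Ω : Lp ℝ 2 (Measure.pi fun _ : Edge 3 N => haarProbability G)) : Measure (GaugeConfig 3 N G × GaugeConfig 3 N G) :=
  ((Measure.pi fun _ : Edge 3 N => haarProbability G).prod (Measure.pi fun _ : Edge 3 N => haarProbability G)).withDensity
    fun p => ENNReal.ofReal (Ω p.1 * wilsonSliceKernel ρ β p.1 p.2 * Ω p.2 / ‖wilsonTorusTransferMatrix ρ β N‖)

end SliceChain

/-! ## §1 The v4 currencies (VERBATIM bodies; renamed, since the v3 bodies own the v4 names in the tree) -/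

section Currency

variable (G : Type) [Group G] [TopologicalSpace G] [IsTopologicalGroup G] [CompactSpace G]
  [MeasurableSpace G] [BorelSpace G]

/-- **ONE-STEP CONDUCTANCE IN UNITS, vacuum-state form** (skeleton v4's `SliceConductanceInUnits`, body verbatim; the LOAD of the line, OPEN):
for `β ≥ β₂`, `S ≥ S₁ β`, every vacuum vector `Ω` of the spatial torus `(2S+1)³` and every measurable set `A` of time-zero slice configurations,
`c·√(a β)·π(A)·π(Aᶜ) ≤ Q(A × Aᶜ)` — literally `HasCouplingConductance π Q (c√(aβ))` of the Lawler–Sokal file. -/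
def VacuumConductanceInUnits (r : LatticeRep G) (a : ℝ → ℝ) : Prop :=
  ∃ (c β₂ : ℝ) (S₁ : ℝ → ℕ), 0 < c ∧ ∀ β : ℝ, β₂ ≤ β → ∀ S : ℕ, S₁ β ≤ S →
    haveI : NeZero (2 * S + 1) := ⟨by omega⟩
    ∀ Ω : Lp ℝ 2 (Measure.pi fun _ : Edge 3 (2 * S + 1) => haarProbability G), IsVacuum r.ρ β (2 * S + 1) Ω →
      Literature.Probability.MarkovChains.HasCouplingConductance
        (vacuumMeasure Ω) (vacuumCoupling r.ρ β (2 * S + 1) Ω) (c * Real.sqrt (a β))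

/-- **RUNG, vacuum-state form** (skeleton v4's `SliceConductanceStrongCoupling`, body verbatim; OPEN, not proved here): strong-coupling
one-step conductance of the vacuum chain, uniformly in the volume. -/
def VacuumConductanceStrongCoupling (r : LatticeRep G) : Prop :=
  ∃ (c β₀ : ℝ), 0 < c ∧ 0 < β₀ ∧ ∀ β : ℝ, 0 ≤ β → β ≤ β₀ → ∀ S : ℕ,
    haveI : NeZero (2 * S + 1) := ⟨by omega⟩
    ∀ Ω : Lp ℝ 2 (Measure.pi fun _ : Edge 3 (2 * S + 1) => haarProbability G), IsVacuum r.ρ β (2 * S + 1) Ω →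
      Literature.Probability.MarkovChains.HasCouplingConductance
        (vacuumMeasure Ω) (vacuumCoupling r.ρ β (2 * S + 1) Ω) c

end Currency

/-! ## §2 The seam on one torus -/

section PerTorus

variable {G : Type} [Group G] [TopologicalSpace G] [IsTopologicalGroup G] [CompactSpace G] [MeasurableSpace G] [BorelSpace G]
  [SecondCountableTopology G] {n : ℕ} {ρ : G →* Matrix (Fin n) (Fin n) ℂ}

/-- **The v4 Cheeger seam on one torus.**  For continuous unitary `ρ`, `β ≥ 0`, a spatial torus `(2S+1)³` and `k ≥ 0`: if every vacuum vector's
coupling has setwise conductance `k`, then `traceExcess (m+2) ≤ K e^{−(k²/8)(m+2)}` for all `m`. -/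
theorem traceExcess_le_of_vacuumConductance (hρ : Continuous ρ) (hρu : ∀ g, ρ g ∈ Matrix.unitaryGroup (Fin n) ℂ)
    {β : ℝ} (hβ : 0 ≤ β) (S : ℕ) {k : ℝ} (hk : 0 ≤ k)
    (hcond : ∀ Ω : Lp ℝ 2 (Measure.pi fun _ : Edge 3 (2 * S + 1) => haarProbability G), IsVacuum ρ β (2 * S + 1) Ω →
      HasCouplingConductance (vacuumMeasure Ω) (vacuumCoupling ρ β (2 * S + 1) Ω) k) :
    ∃ Kc : ℝ, ∀ m : ℕ, traceExcess ρ β (2 * S + 1) (m + 2) ≤ Kc * Real.exp (-(k ^ 2 / 8 * ((m + 2 : ℕ) : ℝ))) := by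
  classical
  set N : ℕ := 2 * S + 1 with hN
  set μ : Measure (GaugeConfig 3 N G) := Measure.pi fun _ : Edge 3 N => haarProbability G with hμ
  set K : GaugeConfig 3 N G → GaugeConfig 3 N G → ℝ := wilsonSliceKernel ρ β with hKdef
  set A := wilsonTorusTransferMatrix ρ β N with hAdef
  -- kernel facts
  have hK : StronglyMeasurable (uncurry K) := stronglyMeasurable_uncurry_wilsonSliceKernel ρ hρ β
  obtain ⟨C, hC⟩ := exists_norm_wilsonSliceKernel_le (L := N) ρ hρ β
  have hsymm : ∀ x y, K x y = K y x := wilsonSliceKernel_symm ρ hρu β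
  have hpos : ∀ x y, 0 < K x y := wilsonSliceKernel_pos ρ hρ β
  obtain ⟨κ₀, hκ₀, hKmin⟩ : ∃ κ₀ : ℝ, 0 < κ₀ ∧ ∀ U U' : GaugeConfig 3 N G, κ₀ ≤ K U U' := by
    have hcont := continuous_uncurry_wilsonSliceKernel (L := N) ρ hρ β
    obtain ⟨p, -, hp⟩ := isCompact_univ.exists_isMinOn univ_nonempty hcont.continuousOn
    exact ⟨K p.1 p.2, hpos p.1 p.2, fun U U' => (isMinOn_iff.mp hp) (U, U') (mem_univ _)⟩
  have hKnn : ∀ x y, 0 ≤ K x y := fun x y => (hpos x y).le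
  have hAker : ∀ φ : Lp ℝ 2 μ, (A φ : GaugeConfig 3 N G → ℝ) =ᵐ[μ] fun U => ∫ U', K U U' * φ U' ∂μ :=
    wilsonTorusTransferMatrix_ae_eq β N hρ
  have hsa : IsSelfAdjoint A := isSelfAdjoint_wilsonTorusTransferMatrix N hρ hρu β
  have hcpt : IsCompactOperator A := isCompactOperator_wilsonTorusTransferMatrix β N hρ
  have himp : IsPositivityImproving A := isPositivityImproving_wilsonTorusTransferMatrix β N hρ
  have hA0 : A ≠ 0 := wilsonTorusTransferMatrix_ne_zero β N hρ
  -- spectral data and the trace formula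
  obtain ⟨s, hs, b, lam, i₀, hb, hle, hL0, hi₀, hS2, hrad, hZ⟩ :=
    exists_spectralData_wilsonTorusTransferMatrix N hρ hρu hβ
  haveI : Countable s := hs
  have hlam0 : ∀ i, 0 ≤ lam i := fun i => (hle i).1
  -- ground-state data
  obtain ⟨h, B, h₀, θ, hhm, hhB, hh₀, hlow, heig, hnorm, ⟨ε, hε2, hbε⟩, horth, hθ0, hθ, hgapl⟩ :=
    exists_groundState_data (μ := μ) hK hC hsymm hpos hκ₀ hKmin hAker hsa hcpt himp hA0 hb hlam0 hi₀
  set lam₀ : ℝ := lam i₀ with hlam₀def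
  have hhpos : ∀ x, 0 < h x := fun x => hh₀.trans_le (hlow x)
  -- the vacuum vector `Ω = [h]`
  set Ω : Lp ℝ 2 μ := (memLp_two_of_bound (μ := μ) hhm hhB).toLp h with hΩdef
  have hcoe : (Ω : GaugeConfig 3 N G → ℝ) =ᵐ[μ] h := MemLp.coeFn_toLp _
  have hΩ1 : ‖Ω‖ = 1 := by
    have h1 := norm_toLp_sq_eq_integral_norm_sq (𝕜 := ℝ) (memLp_two_of_bound (μ := μ) hhm hhB)
    have h2 : ∫ x, ‖h x‖ ^ 2 ∂μ = 1 := by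
      rw [← hnorm]; refine integral_congr_ae (Eventually.of_forall fun x => ?_); simp only [Real.norm_eq_abs, sq_abs]
    rw [h2] at h1
    have h3 : ‖Ω‖ ^ 2 = 1 := h1
    nlinarith [norm_nonneg Ω]
  have hAΩ : A Ω = ‖A‖ • Ω := by
    rw [← hi₀]
    refine Lp.ext ?_
    filter_upwards [hAker Ω, Lp.coeFn_smul (lam i₀) Ω, hcoe] with x hx hs' hc
    rw [hx, hs', Pi.smul_apply, smul_eq_mul, hc, ← heig x]
    exact integral_congr_ae (by filter_upwards [hcoe] with y hy; rw [hy])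
  have hΩpos : IsStrictlyPositiveFun Ω := by
    show ∀ᵐ x ∂μ, 0 < (Ω : GaugeConfig 3 N G → ℝ) x
    filter_upwards [hcoe] with x hx
    rw [hx]; exact hhpos x
  have hvac : IsVacuum ρ β N Ω := ⟨hΩ1, hAΩ, hΩpos⟩
  have hcc := hcond Ω hvac
  -- the vacuum measure / coupling of `Ω = [h]` are the ground-state measures of `h`
  set D : GaugeConfig 3 N G × GaugeConfig 3 N G → ℝ := fun p => lam₀⁻¹ * (h p.1 * K p.1 p.2 * h p.2) with hD
  have hKm : Measurable (uncurry K) := hK.measurable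
  have hDm : Measurable D := measurable_const.mul (((hhm.comp measurable_fst).mul hKm).mul (hhm.comp measurable_snd))
  have hD0 : ∀ p, 0 ≤ D p := fun p =>
    mul_nonneg (inv_nonneg.2 hL0.le) (mul_nonneg (mul_nonneg (hhpos _).le (hKnn _ _)) (hhpos _).le)
  have hμu : μ (univ : Set (GaugeConfig 3 N G)) ≠ 0 := by rw [measure_univ]; exact one_ne_zero
  obtain ⟨x₀, -⟩ : (univ : Set (GaugeConfig 3 N G)).Nonempty := nonempty_of_measure_ne_zero hμu
  have hB0 : 0 ≤ B := (norm_nonneg _).trans (hhB x₀)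
  have hC0 : 0 ≤ C := (norm_nonneg _).trans (hC x₀ x₀)
  have hDb : ∀ p, ‖D p‖ ≤ lam₀⁻¹ * (B * C * B) := by
    intro p
    rw [hD]
    refine norm_mul_le_of_le (by rw [Real.norm_eq_abs, abs_of_nonneg (inv_nonneg.2 hL0.le)]) ?_ (inv_nonneg.2 hL0.le)
    exact norm_mul_le_of_le (norm_mul_le_of_le (hhB _) (hC _ _) hB0) (hhB _) (mul_nonneg hB0 hC0)
  have hDi : Integrable D (μ.prod μ) := integrable_of_bdd hDm hDb
  have hπeq : vacuumMeasure Ω = μ.withDensity (fun x => ENNReal.ofReal (h x ^ 2)) := by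
    unfold vacuumMeasure
    refine withDensity_congr_ae ?_
    filter_upwards [hcoe] with x hx
    rw [hx]
  have hρeq : vacuumCoupling ρ β N Ω = (μ.prod μ).withDensity (fun p => ENNReal.ofReal (D p)) := by
    unfold vacuumCoupling
    refine withDensity_congr_ae ?_
    have h1 : (fun p : GaugeConfig 3 N G × GaugeConfig 3 N G => (Ω : GaugeConfig 3 N G → ℝ) p.1) =ᵐ[μ.prod μ] fun p => h p.1 :=
      Measure.quasiMeasurePreserving_fst.ae_eq_comp hcoe
    have h2 : (fun p : GaugeConfig 3 N G × GaugeConfig 3 N G => (Ω : GaugeConfig 3 N G → ℝ) p.2) =ᵐ[μ.prod μ] fun p => h p.2 :=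
      Measure.quasiMeasurePreserving_snd.ae_eq_comp hcoe
    filter_upwards [h1, h2] with p hp1 hp2
    rw [hp1, hp2, ← hi₀, hD]
    simp only
    congr 1
    rw [div_eq_inv_mul]
  -- set functions of the ground-state measures
  have hh2m : Measurable fun x => h x ^ 2 := hhm.pow_const 2
  have hh2b : ∀ x, ‖h x ^ 2‖ ≤ B ^ 2 := fun x => by
    rw [Real.norm_eq_abs, abs_of_nonneg (sq_nonneg _)]
    have := hhB x
    rw [Real.norm_eq_abs] at this
    calc h x ^ 2 = |h x| ^ 2 := (sq_abs _).symm
      _ ≤ B ^ 2 := pow_le_pow_left₀ (abs_nonneg _) this 2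
  have hh2i : Integrable (fun x => h x ^ 2) μ := integrable_of_bdd hh2m hh2b
  have hπA : ∀ Aset : Set (GaugeConfig 3 N G), MeasurableSet Aset → (vacuumMeasure Ω).real Aset = ∫ x in Aset, h x ^ 2 ∂μ := by
    intro Aset hA
    rw [measureReal_def, hπeq, withDensity_apply _ hA,
      ← ofReal_integral_eq_lintegral_ofReal hh2i.integrableOn (Eventually.of_forall fun x => sq_nonneg (h x)),
      ENNReal.toReal_ofReal (setIntegral_nonneg hA fun x _ => sq_nonneg _)]
  haveI hπprob : IsProbabilityMeasure (vacuumMeasure Ω) := by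
    refine ⟨?_⟩
    rw [hπeq, withDensity_apply _ MeasurableSet.univ, Measure.restrict_univ,
      ← ofReal_integral_eq_lintegral_ofReal hh2i (Eventually.of_forall fun x => sq_nonneg (h x)), hnorm, ENNReal.ofReal_one]
  have hρAE : ∀ Aset E : Set (GaugeConfig 3 N G), MeasurableSet Aset → MeasurableSet E →
      (vacuumCoupling ρ β N Ω).real (Aset ×ˢ E) = ∫ x in Aset, ∫ y in E, D (x, y) ∂μ ∂μ := by
    intro Aset E hA hE
    rw [measureReal_def, hρeq, withDensity_apply _ (hA.prod hE),
      ← ofReal_integral_eq_lintegral_ofReal hDi.integrableOn (Eventually.of_forall fun p => hD0 p),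
      ENNReal.toReal_ofReal (setIntegral_nonneg (hA.prod hE) fun p _ => hD0 p), setIntegral_prod D hDi.integrableOn]
  have hrow : ∀ x, ∫ y, D (x, y) ∂μ = h x ^ 2 := by
    intro x
    simp only [hD]
    rw [integral_const_mul]
    have : ∫ y, h x * K x y * h y ∂μ = h x * ∫ y, K x y * h y ∂μ := by
      rw [← integral_const_mul]
      refine integral_congr_ae (Eventually.of_forall fun y => ?_); ring
    rw [this, heig x]
    field_simp
  have hDx : ∀ x, Integrable (fun y => D (x, y)) μ := fun x =>
    integrable_of_bdd (hDm.comp measurable_prodMk_left) fun y => hDb (x, y)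
  -- the setwise conductance of the ground state
  have hconduct : ∀ Aset : Set (GaugeConfig 3 N G), MeasurableSet Aset →
      k * (∫ x in Aset, h x ^ 2 ∂μ) * (1 - ∫ x in Aset, h x ^ 2 ∂μ) ≤
        (∫ x in Aset, h x ^ 2 ∂μ) - lam₀⁻¹ * ∫ x in Aset, ∫ y in Aset, h x * K x y * h y ∂μ ∂μ := by
    intro Aset hA
    have h1 := hcc Aset hA
    have hPc : (vacuumMeasure Ω).real Asetᶜ = 1 - ∫ x in Aset, h x ^ 2 ∂μ := by
      rw [probReal_compl_eq_one_sub hA, hπA Aset hA]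
    have hR : (vacuumCoupling ρ β N Ω).real (Aset ×ˢ Asetᶜ) =
        (∫ x in Aset, h x ^ 2 ∂μ) - lam₀⁻¹ * ∫ x in Aset, ∫ y in Aset, h x * K x y * h y ∂μ ∂μ := by
      rw [hρAE Aset Asetᶜ hA hA.compl]
      have hin : ∀ x, ∫ y in Asetᶜ, D (x, y) ∂μ = h x ^ 2 - ∫ y in Aset, D (x, y) ∂μ := by
        intro x
        rw [setIntegral_compl hA (hDx x), hrow x]
      simp_rw [hin]
      have hDunc : StronglyMeasurable (uncurry fun x y => D (x, y)) :=
        (hDm.comp (measurable_fst.prodMk measurable_snd)).stronglyMeasurable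
      rw [integral_sub hh2i.integrableOn ?_]
      · congr 1
        rw [← integral_const_mul]
        refine setIntegral_congr_fun hA fun x _ => ?_
        rw [← integral_const_mul]
      · refine (integrable_of_bdd (B := lam₀⁻¹ * (B * C * B) * μ.real univ) ?_ fun x => ?_).integrableOn
        · exact (hDunc.integral_prod_right' (ν := μ.restrict Aset)).measurable
        · rw [Real.norm_eq_abs]
          calc |∫ y in Aset, D (x, y) ∂μ| ≤ ∫ y in Aset, |D (x, y)| ∂μ := abs_integral_le_integral_abs
            _ ≤ ∫ y in Aset, lam₀⁻¹ * (B * C * B) ∂μ := by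
                refine setIntegral_mono_on ?_ ?_ hA fun y _ => ?_
                · exact (hDx x).abs.integrableOn
                · exact (integrable_const _).integrableOn
                · have := hDb (x, y); rwa [Real.norm_eq_abs] at this
            _ = lam₀⁻¹ * (B * C * B) * μ.real Aset := by rw [setIntegral_const, smul_eq_mul, mul_comm]
            _ ≤ lam₀⁻¹ * (B * C * B) * μ.real univ :=
                mul_le_mul_of_nonneg_left (measureReal_mono (subset_univ _) (measure_ne_top _ _))
                  (mul_nonneg (inv_nonneg.2 hL0.le) (mul_nonneg (mul_nonneg hB0 hC0) hB0))
    rw [hπA Aset hA, hPc, hR] at h1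
    exact h1
  -- the excited spectrum and the trace excess (as in `traceExcess_le_of_sliceConductance`)
  set r : s → ℝ := fun i => lam i / lam₀ with hr
  have hr0 : ∀ i, 0 ≤ r i := fun i => div_nonneg (hlam0 i) hL0.le
  have hri₀ : r i₀ = 1 := div_self hL0.ne'
  have hrsum : Summable fun i => r i ^ 2 := by
    have := hS2.div_const (lam₀ ^ 2)
    refine this.congr fun i => ?_
    rw [hr]; simp only; rw [div_pow]
  have hlam_eq : ∀ i (j : ℕ), lam i ^ j = lam₀ ^ j * r i ^ j := fun i j => by
    rw [← mul_pow, hr]; simp only; rw [mul_div_cancel₀ _ hL0.ne']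
  set u : ℝ := max (1 - k ^ 2 / 8) 0 with hu
  have hu0 : 0 ≤ u := le_max_right _ _
  have hru : ∀ i, i ≠ i₀ → r i ≤ u := by
    intro i hi
    by_cases hli : lam i = 0
    · rw [hr]; simp only; rw [hli, zero_div]; exact hu0
    · have hlipos : 0 < lam i := lt_of_le_of_ne (hlam0 i) (Ne.symm hli)
      have h1 := eigenvalue_le_of_conductance (μ := μ) hK hC hsymm hKnn hhm hhB hh₀ hlow hL0 heig hnorm hk hconduct hAker
        (hb i) hlipos (b.orthonormal.norm_eq_one i) (horth i hi)
      rw [hr]; simp only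
      rw [div_le_iff₀ hL0]
      calc lam i ≤ lam₀ * (1 - k ^ 2 / 8) := h1
        _ ≤ u * lam₀ := by rw [mul_comm]; exact mul_le_mul_of_nonneg_right (le_max_left _ _) hL0.le
  have huexp : u ≤ Real.exp (-(k ^ 2 / 8)) := by
    refine max_le ?_ (Real.exp_pos _).le
    have := Real.add_one_le_exp (-(k ^ 2 / 8)); linarith
  have htr : ∀ m : ℕ, traceExcess ρ β N (m + 2) = ∑' i, (if i = i₀ then 0 else r i ^ (m + 2)) := by
    intro m
    have h1 : HasSum (fun i => r i ^ (m + 2)) (cyclicPartition ρ β N (m + 2) / lam₀ ^ (m + 2)) := by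
      have := (hZ m).div_const (lam₀ ^ (m + 2))
      refine this.congr_fun fun i => ?_
      rw [hlam_eq i (m + 2), mul_div_cancel_left₀ _ (pow_ne_zero _ hL0.ne')]
    have hsumm : Summable fun i => r i ^ (m + 2) := h1.summable
    unfold traceExcess
    rw [hrad, ← h1.tsum_eq, hsumm.tsum_eq_add_tsum_ite i₀, hri₀, one_pow]
    ring
  set x₂ : ℝ := ∑' i, (if i = i₀ then 0 else r i ^ 2) with hx₂
  refine ⟨x₂ * Real.exp (k ^ 2 / 4), fun m => ?_⟩
  rw [htr m]
  have hterm : ∀ i, (if i = i₀ then 0 else r i ^ (m + 2)) ≤ (if i = i₀ then 0 else r i ^ 2) * u ^ m := by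
    intro i
    split_ifs with hi
    · simp
    · rw [pow_add, mul_comm]
      exact mul_le_mul_of_nonneg_left (pow_le_pow_left₀ (hr0 i) (hru i hi) m) (sq_nonneg _)
  have hsum1 : Summable fun i => (if i = i₀ then 0 else r i ^ 2) := by
    refine Summable.of_nonneg_of_le (fun i => ?_) (fun i => ?_) hrsum
    · split_ifs <;> positivity
    · split_ifs <;> [exact sq_nonneg _; exact le_rfl]
  have hsum2 : Summable fun i => (if i = i₀ then 0 else r i ^ (m + 2)) := by
    refine Summable.of_nonneg_of_le (fun i => ?_) hterm (hsum1.mul_right _)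
    split_ifs
    · exact le_rfl
    · exact pow_nonneg (hr0 i) _
  have hx₂0 : 0 ≤ x₂ := tsum_nonneg fun i => by
    split_ifs
    · exact le_rfl
    · exact sq_nonneg _
  calc ∑' i, (if i = i₀ then 0 else r i ^ (m + 2)) ≤ ∑' i, (if i = i₀ then 0 else r i ^ 2) * u ^ m :=
        Summable.tsum_le_tsum hterm hsum2 (hsum1.mul_right _)
    _ = x₂ * u ^ m := tsum_mul_right
    _ ≤ x₂ * Real.exp (-(k ^ 2 / 8)) ^ m := mul_le_mul_of_nonneg_left (pow_le_pow_left₀ hu0 huexp m) hx₂0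
    _ = x₂ * Real.exp (k ^ 2 / 4) * Real.exp (-(k ^ 2 / 8 * ((m + 2 : ℕ) : ℝ))) := by
        rw [← Real.exp_nat_mul, mul_assoc, ← Real.exp_add]
        congr 1; congr 1; push_cast; ring

end PerTorus

/-- **The v4 Cheeger seam PROVED**: vacuum-state conductance in units ⇒ the gap face, `c₁ = c²/8`.  After renaming v4's load to
`VacuumConductanceInUnits`, the registered stub `stub_cheeger` of skeleton v4 closes by `exact vacuumConductance_imp_sliceGap`. -/
theorem vacuumConductance_imp_sliceGap :
    ∀ (G : Type) [Group G] [TopologicalSpace G] [IsTopologicalGroup G] [CompactSpace G]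
      [MeasurableSpace G] [BorelSpace G] (r : LatticeRep G) (a : ℝ → ℝ), (∀ β, 0 < a β) →
      VacuumConductanceInUnits G r a → SliceGapInUnits G r a := by
  intro G _ _ _ _ _ _ r a ha hcond
  obtain ⟨c, β₂, S₁, hc, hcond⟩ := hcond
  haveI : SecondCountableTopology G :=
    (r.continuous.isClosedEmbedding r.injective).isEmbedding.secondCountableTopology
  refine ⟨c ^ 2 / 8, max β₂ 0, S₁, by positivity, fun β hβ S hS => ?_⟩
  have hβ0 : 0 ≤ β := le_trans (le_max_right _ _) hβ
  have hβ2 : β₂ ≤ β := le_trans (le_max_left _ _) hβ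
  have hk : 0 ≤ c * Real.sqrt (a β) := mul_nonneg hc.le (Real.sqrt_nonneg _)
  obtain ⟨Kc, hKc⟩ := traceExcess_le_of_vacuumConductance (ρ := r.ρ) r.continuous r.mem_unitary hβ0 S hk
    (fun Ω hΩ => hcond β hβ2 S hS Ω hΩ)
  refine ⟨Kc, fun t ht => ?_⟩
  obtain ⟨m, rfl⟩ : ∃ m, t = m + 2 := ⟨t - 2, by omega⟩
  have hk2 : (c * Real.sqrt (a β)) ^ 2 / 8 = c ^ 2 / 8 * a β := by
    rw [mul_pow, Real.sq_sqrt (ha β).le]; ring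
  have := hKc m
  rw [hk2] at this
  simpa [mul_assoc] using this

end Summit.QuantumFields.YangMills.Cruxes.IR.VacuumEscape

end
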